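import Literature.Computability.QuantumComplexity.PauliWeightTruncation
import Literature.Computability.QuantumComplexity.PauliReduce
import Mathlib.Analysis.Complex.Basic
import HarnessLib

/-!
# Low-weight Pauli propagation on locally scrambling circuits: the mean-squared error is at most
# `(2/3)^{k+1} ‖O‖²_{Pauli,2}` (Angrisani–Schmidhuber–Rudolph–Cerezo–Holmes–Huang, PRL 2025)

Topic `Literature/Computability/QuantumComplexity`, sub-namespace `LocalScrambling` (the model: layered
circuits whose layers are followed by local single-qubit scrambling frames). Cell `qa-dq` (D-0147), census
row DQ-N10 «NOISELESS but RANDOM (locally scrambling) circuits; weight-`k` Pauli truncation»; this file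
turns that row from MISSING into PROVED: the printed Theorem 1 is a kernel theorem here, with 0 named
facts.

HONEST FRAMING (cell charter): an AVERAGE-CASE accuracy guarantee for ONE classical estimator (weight
truncation of the Heisenberg-evolved observable) over ensembles of circuits that look locally random; it
says nothing about any fixed structured circuit (the source's §III: single-axis rotation circuits are not
covered), nothing about running time (their Theorem 2 counts `n^{O(k)}` Pauli strings — an algorithmic
sentence not typed here), and nothing about BQP vs BPP.

## Source (read on the page: `lit read arxiv:2409.01706`, tex chunks p0004–p0006, p0012, p0014–p0020)

A. Angrisani, A. Schmidhuber, M. S. Rudolph, M. Cerezo, Z. Holmes, H.-Y. Huang, *Classically estimating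
observables of noiseless quantum circuits*, Phys. Rev. Lett. 135, 170602 (2025) = arXiv:2409.01706
[AngrisaniEtAl2024].

* §2 Framework (p0004 L1–20): `f_U(O) := Tr[U ρ U† O]`, `U = U_L ⋯ U_1`, "each layer `U_j` … equipped
  with a locally scrambling distribution …, that is, a distribution that is invariant under rotation by
  random single-qubit Clifford gates"; **Definition 5** (p0014 L67–73): "`𝒟` is locally scrambling if
  for all Hermitian `H, H'`: `E_U[U^{⊗2}(H⊗H')U†^{⊗2}] = E_U E_{V_1,…,V_n∼Cl(2)}[(⊗V_i)^{⊗2} U^{⊗2}(H⊗H')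
  U†^{⊗2}(⊗V_i†)^{⊗2}]`, that is, `𝒟` is invariant under post-processing by random single-qubit
  Cliffords up to the second moment"; **Definition 6**: the layers are sampled independently.
* §3 Algorithm (p0005 L9–22): "`O_L := Σ_{|P| ≤ k} a_P P`"; "for `j = L, L−1, …, 2` … `O_{j−1} :=
  2^{−n} Σ_{|P| ≤ k} Tr[U_j† O_j U_j P] P`"; "at the end … `O^{(k)}_U := U_1† O_1 U_1` … and we compute
  `Tr[O^{(k)}_U ρ]`"; §4: "`f̃^{(k)}_U(O) := Tr[O^{(k)}_U ρ]`", "`E_U(Δf^{(k)}_U(O)) := E_U[(f_U(O) −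
  f̃^{(k)}_U(O))²]`" (p0006 L5–12).
* **Theorem 1 (Mean squared error)** (p0006 L17–22): "For `k ≥ 0`, we have
  `E_U(Δf^{(k)}_U(O)) ≤ (2/3)^{k+1} ‖O‖²_{Pauli,2}`, where `‖O‖_{Pauli,2} := (2^{−n}Tr[O†O])^{1/2}`."
  Appendix form **Theorem 17** (p0020 L1–4): "`E_U Δf^{(k)}_U ≤ (2/3)^{k+1}(‖O‖²_{Pauli,2} −
  E_U‖O^{(k)}_U‖²_{Pauli,2})`"; **Corollary 18** (p0020 L24–31): "`k ≥ log(2/(3ε²δ))/log(3/2)` … then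
  `|f_U(O) − f̃^{(k)}_U(O)| ≤ ε‖O‖_{Pauli,2}` with probability at least `1−δ`" (Markov).
* The proof ingredients (Appendix 9.2–11): **Lemma 7** (p0014 L84–p0015 L31: orthogonality
  `E_U[U†^{⊗2}(P⊗Q)U^{⊗2}] = 0` for `P ≠ Q` and Pauli mixing, from "the Clifford group forms an exact
  2-design", eq. (cliffs): `E_{V∼Cl(2)} V†^{⊗2}(P_i⊗Q_i)V^{⊗2} = I⊗I | ⅓(X⊗X+Y⊗Y+Z⊗Z) | 0`);
  **Lemma 8** (vanishing cross terms); **Lemma 10** (p0015 L89–p0016: `E_U Tr[U†PUρ]² ≤ (2/3)^{|P|}`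
  via the purity of the reduced state on `supp(P)`); **Lemma 11** / **Corollary 16** (one truncation
  step costs `(2/3)^{k+1}(‖O_{j+1}‖² − ‖O_j‖²)`); Theorem 17 by telescoping.

## What is typed, and why it is the printed theorem

The probabilistic content of Definition 5 is a SECOND-MOMENT invariance under local single-qubit
twirls, and the proof uses exactly the two identities of Lemma 7. We type the FINITE-ENSEMBLE KERNEL of
the statement: fix ANY layer unitaries `U_0, …, U_{L−1}` (the skeleton) and insert after every layer a
local frame `F_φ = σ_V · ⊗_i K^{m_i}` (`V ∈ {I,X,Y,Z}^ι` a Pauli string, `m ∈ {0,1,2}^ι`, `K = e^{iπ/4}SH`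
the axis-cycling Clifford with `K†XK = Y, K†YK = Z, K†ZK = X`); the per-qubit frame set
`{σ_Q K^r}` (12 elements, the tetrahedral subgroup of the single-qubit Clifford group) satisfies the two
identities of Lemma 7 — PROVED here as `sum_frame_mul_star_eq_zero` (orthogonality, from the Pauli
characters already in `PauliPathOrthogonality.lean`) and `sum_rotStr_apply_mul_star` (Pauli mixing, from
the axis cycling). The theorems below bound the UNIFORM AVERAGE over all `12^{nL}` frame choices
`φ : Fin L → Frame ι` of the squared error, for every skeleton. For a locally scrambling circuit
distribution in the sense of Definitions 5–6 the layer-`j` marginal is invariant (in second moments,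
which is all the squared error involves, layer by layer by independence) under post-composition by
uniformly random single-qubit Cliffords, hence under the uniform measure on any subgroup of `Cl(2)^{⊗n}`
(average the `Cl(2)`-invariance over the subgroup), in particular under our frames; so
`E_U Δf = E_U E_φ Δf(framed U) ≤ (2/3)^{k+1}‖O‖²` by the kernel theorem applied to every skeleton.
TODO(general form): continuous ensembles / the averaging-over-`U(2^n)` sentence itself is not a Lean
object here (as for the AGLLV23 Pauli-frame ensemble of `PauliPathOrthogonality.lean`).

The algorithm is typed literally: `heisTrunc k L W O` truncates to weight `≤ k` (`PauliPath.truncWeight`),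
conjugates by the top layer, and recurses, with NO truncation after the bottom layer
(`O^{(k)}_U = U_1† O_1 U_1`); `heisExact L W O = W† O W` (`= (circuitUnitary L W)ᴴ O (circuitUnitary L W)`,
proved), so `Tr[heisExact · ρ] = noisyValue 0 W ρ O = Tr[O · WρW†] = f_U(O)` (proved,
`trace_heisExact_mul`). States are density matrices (`PosSemidef`, trace `1`); observables are arbitrary
complex matrices (the printed `O` is Hermitian; the bound holds verbatim for all `O` with `|·|²`).

## Contents (all proved; 0 named facts; net D-0026 debt 0)

single-qubit: `cycMat` (`K`), `rot`, `cycMat_unitary`, `cycMat_conj_mat`; frames: `cyc`, `rotN`, `cycAll`,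
`rotStr`, `Frame`, `frameU`, `frameU_unitary`, `frameU_conj_pauliString`, `card_frame` (`= 12^n`);
Lemma 7: `sum_frame_mul_star_eq_zero` (orthogonality), `sum_rotN_mat_mul_star` / `sum_rotStr_apply_mul_star`
/ `sum_norm_trace_rotStr_sq` (Pauli mixing); Lemma 10: `pauliWeight_le_two_pow` (purity of the reduced
state, via `PauliReduce.lean`), `sum_frame_norm_trace_sq_le` (`≤ 12^n (2/3)^{|P|}`); Lemma 8/9/11 cores:
`sum_frame_norm_trace_conj_sq` (frame Parseval), `sum_frame_apply_conj_mul_star_eq_zero` (cross terms of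
operators with disjoint Pauli support vanish), `sum_frame_norm_trace_conj_sq_le` (a twirled weight-`> k`
observable read out on a state has second moment `≤ 12^n (2/3)^{k+1}‖Y‖²_F`); the algorithm:
`heisExact`, `heisTrunc`, `lowWeightValue`, `framed`; the estimate: `mse_le_aux` (Theorem 17 by induction
on `L`, peeling the top layer: Corollary 16 + orthogonality), **`lowWeight_mse_le` = Theorem 1**,
`lowWeight_mse_le_sharp` = Theorem 17, `card_lowWeight_error_gt_le` = Corollary 18 (counting form).

## Deliberately NOT here

Theorem 2 (time `L·n^{O(log(1/(εδ)))}`; a statement about an algorithm enumerating `n^{O(k)}` strings),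
Theorem 3 (classical shadows), Theorem 4 (certified numerical error estimates), Lemma 19 ff. (counting
light cones); the full 24-element Clifford group as the frame set (ours is its 12-element 2-design
subgroup, which is what the proof needs and what Definition-5 ensembles are a fortiori invariant under).
-/

noncomputable section

open Matrix Finset Complex
open scoped ComplexOrder

namespace Literature.Computability.QuantumComplexity

namespace LocalScrambling

open PauliPath

/-! ### The axis-cycling single-qubit Clifford and the frame alphabet -/

/-- The **axis-cycling Clifford** `K = e^{iπ/4} S H = ½[[1+i, 1+i],[−1+i, 1−i]]` on one qubit
(`false = |0⟩`): the single-qubit Clifford with `K† X K = Y`, `K† Y K = Z`, `K† Z K = X` (all signs `+`).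
[folklore] -/
def cycMat : Matrix Bool Bool ℂ :=
  Matrix.of fun a b => if a then (if b then (1 - I) / 2 else (-1 + I) / 2) else (1 + I) / 2

/-- Entries of `K`. [folklore] -/
@[simp] private theorem cycMat_apply (a b : Bool) :
    cycMat a b = if a then (if b then (1 - I) / 2 else (-1 + I) / 2) else (1 + I) / 2 := rfl

/-- The cyclic relabelling of the Pauli axes `X ↦ Y ↦ Z ↦ X`, `I ↦ I` induced by `P ↦ K† P K`. [folklore] -/
def rot : Pauli → Pauli
  | Pauli.I => Pauli.I
  | Pauli.X => Pauli.Y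
  | Pauli.Y => Pauli.Z
  | Pauli.Z => Pauli.X

/-- `K` is unitary: `K† K = 1` (a single-qubit Clifford gate).
[cite: AngrisaniEtAl2024, §2 and Definition 5 (random single-qubit Clifford gates)] -/
theorem cycMat_unitary : cycMatᴴ * cycMat = 1 := by
  ext a b
  simp only [Pauli.mul_apply_bool, Matrix.conjTranspose_apply, cycMat_apply, Matrix.one_apply]
  cases a <;> cases b <;> simp [Complex.ext_iff] <;> norm_num

/-- **The conjugation table of `K`**: `K† σ_P K = σ_{rot P}` (`X ↦ Y ↦ Z ↦ X`) — `K` is a Clifford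
permuting the three Pauli axes, which is what makes the frame average Pauli-mixing.
[cite: AngrisaniEtAl2024, Lemma 7 (proof: the Clifford twirl mixes X, Y, Z)] -/
theorem cycMat_conj_mat (P : Pauli) : cycMatᴴ * P.mat * cycMat = (rot P).mat := by
  ext a b
  simp only [Pauli.mul_apply_bool, Matrix.conjTranspose_apply, cycMat_apply]
  cases P <;> cases a <;> cases b <;> simp [rot, Complex.ext_iff] <;> norm_num

/-- The three frame rotations `K⁰ = 1, K, K²` of one site. [folklore] -/
def cyc (r : Fin 3) : Matrix Bool Bool ℂ := cycMat ^ (r : ℕ)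

/-- The axis relabelling `rot` iterated `r` times. [folklore] -/
def rotN (r : Fin 3) (P : Pauli) : Pauli := rot^[r] P

/-- Each `K^r` is unitary. [cite: AngrisaniEtAl2024, Definition 5 (single-qubit Clifford gates)] -/
theorem cyc_unitary (r : Fin 3) : (cyc r)ᴴ * cyc r = 1 := by
  have h2 : (cycMat ^ 2)ᴴ * cycMat ^ 2 = 1 := by
    rw [pow_two, conjTranspose_mul, Matrix.mul_assoc, ← Matrix.mul_assoc cycMatᴴ cycMat,
      cycMat_unitary, Matrix.one_mul, cycMat_unitary]
  fin_cases r
  · simp [cyc]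
  · simpa [cyc] using cycMat_unitary
  · simpa [cyc] using h2

/-- `(K^r)† σ_P K^r = σ_{rot^r P}`. [cite: AngrisaniEtAl2024, Lemma 7 (proof: the Clifford twirl mixes X, Y, Z)] -/
theorem cyc_conj_mat (r : Fin 3) (P : Pauli) : (cyc r)ᴴ * P.mat * cyc r = (rotN r P).mat := by
  have h2 : (cycMat ^ 2)ᴴ * P.mat * cycMat ^ 2 = (rot (rot P)).mat := by
    rw [pow_two, conjTranspose_mul]
    calc cycMatᴴ * cycMatᴴ * P.mat * (cycMat * cycMat)
        = cycMatᴴ * (cycMatᴴ * P.mat * cycMat) * cycMat := by simp only [Matrix.mul_assoc]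
      _ = (rot (rot P)).mat := by rw [cycMat_conj_mat, cycMat_conj_mat]
  fin_cases r
  · simp [cyc, rotN]
  · simpa [cyc, rotN] using cycMat_conj_mat P
  · simpa [cyc, rotN] using h2

/-- The relabelling fixes `I` and permutes `{X, Y, Z}`: `rot^r P = I ↔ P = I`. [folklore] -/
private theorem rotN_eq_I_iff (r : Fin 3) (P : Pauli) : rotN r P = Pauli.I ↔ P = Pauli.I := by
  fin_cases r <;> cases P <;> simp [rotN, rot]

/-- The letters a site can carry after relabelling: `{I}` for `I`, `{X, Y, Z}` otherwise (the strings
`Q` with `supp(Q) = supp(P)` of the Pauli-mixing identity, sitewise).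
[cite: AngrisaniEtAl2024, Lemma 7 (Pauli-mixing: sum over supp(Q) = supp(P))] -/
def orbit (Q : Pauli) : Finset Pauli :=
  if Q = Pauli.I then {Pauli.I} else {Pauli.X, Pauli.Y, Pauli.Z}

/-- **Second-moment mixing on one site**: averaging over the three axis rotations,
`Σ_r (σ_{rot^r Q})_{ab} conj((σ_{rot^r Q})_{cd})` is `3 · I_{ab} conj(I_{cd})` for `Q = I` and
`Σ_{Q' ∈ {X,Y,Z}} Q'_{ab} conj(Q'_{cd})` otherwise — the display
`E_{V∼Cl(2)} V†^{⊗2}(P⊗P)V^{⊗2} = ⅓(X^{⊗2}+Y^{⊗2}+Z^{⊗2})` for `P ≠ I` (times `3`), realised by the cyclic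
subgroup. [cite: AngrisaniEtAl2024, Lemma 7 (proof, eq. (cliffs))] -/
theorem sum_rotN_mat_mul_star (Q : Pauli) (a b c d : Bool) :
    ∑ r : Fin 3, (rotN r Q).mat a b * star ((rotN r Q).mat c d) =
      (if Q = Pauli.I then (3 : ℂ) else 1) * ∑ Q' ∈ orbit Q, Q'.mat a b * star (Q'.mat c d) := by
  have hXYZ : ∀ f : Pauli → ℂ, ∑ Q' ∈ ({Pauli.X, Pauli.Y, Pauli.Z} : Finset Pauli), f Q' =
      f Pauli.X + f Pauli.Y + f Pauli.Z := by
    intro f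
    rw [Finset.sum_insert (by decide), Finset.sum_insert (by decide), Finset.sum_singleton, add_assoc]
  rw [Fin.sum_univ_three]
  have h0 : ∀ P, rotN 0 P = P := fun P => rfl
  have h1 : ∀ P, rotN 1 P = rot P := fun P => rfl
  have h2' : ∀ P, rotN 2 P = rot (rot P) := fun P => rfl
  rw [h0, h1, h2']
  cases Q <;> simp only [rot, orbit, if_true, reduceCtorEq, if_false, hXYZ, Finset.sum_singleton] <;> ring

variable {ι : Type*} [Fintype ι] [DecidableEq ι]

/-- The local axis-rotation layer `⊗ᵢ K^{mᵢ}` of a rotation word `m ∈ {0,1,2}^ι`. [folklore] -/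
def cycAll (m : ι → Fin 3) : Matrix (ι → Bool) (ι → Bool) ℂ := tensorAll fun i => cyc (m i)

/-- The sitewise relabelled Pauli string `(rot^{mᵢ} Sᵢ)ᵢ`. [folklore] -/
def rotStr (m : ι → Fin 3) (S : ι → Pauli) : ι → Pauli := fun i => rotN (m i) (S i)

/-- `⊗ᵢ K^{mᵢ}` is unitary. [cite: AngrisaniEtAl2024, Definition 5 (the local unitaries ⊗ᵢ Vᵢ)] -/
theorem cycAll_unitary (m : ι → Fin 3) : (cycAll m)ᴴ * cycAll m = 1 := by
  rw [cycAll, conjTranspose_tensorAll, tensorAll_mul]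
  simp only [cyc_unitary]
  exact tensorAll_one

/-- Conjugating a Pauli string by the axis-rotation layer relabels it sitewise:
`(⊗K^{mᵢ})† S (⊗K^{mᵢ}) = rotStr m S` — a local Clifford maps Pauli strings to Pauli strings of the same
support. [cite: AngrisaniEtAl2024, Lemma 7 (Pauli-mixing: supp(Q) = supp(P))] -/
theorem cycAll_conj_pauliString (m : ι → Fin 3) (S : ι → Pauli) :
    (cycAll m)ᴴ * pauliString S * cycAll m = pauliString (rotStr m S) := by
  rw [cycAll, conjTranspose_tensorAll, pauliString_eq, tensorAll_mul, tensorAll_mul, pauliString_eq]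
  simp only [cyc_conj_mat]
  rfl

omit [DecidableEq ι] in
/-- Relabelling preserves the Hamming weight (the support): `|rotStr m S| = |S|`.
[cite: AngrisaniEtAl2024, Lemma 7 ("the second moment … depends only on the support of the Pauli")] -/
theorem strWeight_rotStr (m : ι → Fin 3) (S : ι → Pauli) :
    strWeight (rotStr m S) = strWeight S := by
  unfold PauliPath.strWeight rotStr
  congr 1
  ext i
  simp [rotN_eq_I_iff]

/-- The **frame alphabet of one layer**: a Pauli string `V` and a rotation word `m`; the per-site set
`{σ_Q K^r : Q ∈ {I,X,Y,Z}, r ∈ {0,1,2}}` is the 12-element tetrahedral subgroup of the single-qubit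
Clifford group (a unitary 2-design), standing in for "random single-qubit Clifford gates".
[cite: AngrisaniEtAl2024, Definition 5 (post-processing by random single-qubit Cliffords)] -/
abbrev Frame (ι : Type*) := (ι → Pauli) × (ι → Fin 3)

/-- The **frame unitary** `F_φ = σ_V · ⊗ᵢ K^{mᵢ}` of a frame `φ = (V, m)`.
[cite: AngrisaniEtAl2024, Definition 5 (the local unitaries ⊗ᵢ Vᵢ)] -/
def frameU (φ : Frame ι) : Matrix (ι → Bool) (ι → Bool) ℂ := pauliString φ.1 * cycAll φ.2

/-- Frame unitaries are unitary: `F_φ† F_φ = 1`. [cite: AngrisaniEtAl2024, Definition 5 (the local unitaries ⊗ᵢ Vᵢ)] -/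
theorem frameU_unitary (φ : Frame ι) : (frameU φ)ᴴ * frameU φ = 1 := by
  rw [frameU, conjTranspose_mul, Matrix.mul_assoc, ← Matrix.mul_assoc (pauliString φ.1)ᴴ,
    conjTranspose_pauliString, pauliString_mul_self, Matrix.one_mul, cycAll_unitary]

/-- **A frame acts on a Pauli string by a sign and a relabelling**:
`F_{(V,m)}† S F_{(V,m)} = sign_V(S) · rotStr m S`. [cite: AngrisaniEtAl2024, Lemma 7 (proof, eq. (cliffs): the local twirl acts sitewise on P = ⊗ᵢ Pᵢ)] -/
theorem frameU_conj_pauliString (φ : Frame ι) (S : ι → Pauli) :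
    (frameU φ)ᴴ * pauliString S * frameU φ = strSign φ.1 S • pauliString (rotStr φ.2 S) := by
  rw [frameU, conjTranspose_mul, conjTranspose_pauliString]
  calc (cycAll φ.2)ᴴ * pauliString φ.1 * pauliString S * (pauliString φ.1 * cycAll φ.2)
      = (cycAll φ.2)ᴴ * (pauliString φ.1 * pauliString S * pauliString φ.1) * cycAll φ.2 := by
        simp only [Matrix.mul_assoc]
    _ = strSign φ.1 S • pauliString (rotStr φ.2 S) := by
        rw [pauliString_conj_eq_strSign_smul, Matrix.mul_smul, Matrix.smul_mul, cycAll_conj_pauliString]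

/-- There are `12^n` frames per layer (`4` Paulis × `3` rotations per site); averages below are sums
divided by this count. [cite: AngrisaniEtAl2024, Definition 5 (E over V_1, …, V_n)] -/
theorem card_frame : Fintype.card (Frame ι) = 12 ^ Fintype.card ι := by
  rw [Fintype.card_prod, Fintype.card_fun, Fintype.card_fun, Pauli.card_univ, Fintype.card_fin,
    ← mul_pow]
  norm_num

/-! ### Lemma 7, orthogonality: distinct Pauli strings decorrelate under the frame average -/

omit [DecidableEq ι] in
/-- The sign character is real: `conj(sign_W(S)) = sign_W(S)`. [folklore] -/
private theorem star_strSign (W S : ι → Pauli) : star (strSign W S) = strSign W S := by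
  rcases OTOC.strSign_eq_one_or W S with h | h <;> simp [h]

omit [DecidableEq ι] in
/-- `|sign_W(S)| = 1`. [folklore] -/
private theorem norm_strSign (W S : ι → Pauli) : ‖strSign W S‖ = 1 := by
  rcases OTOC.strSign_eq_one_or W S with h | h <;> simp [h]

/-- **Orthogonality (Lemma 7, first case), finite-frame form**: for homogeneous functionals `g, h` and
Pauli strings `P ≠ P'`, `Σ_φ g(F_φ† P F_φ) · conj(h(F_φ† P' F_φ)) = 0` — the Pauli part of the frame
already averages the character product `sign_V(P) sign_V(P')` to zero ("`E_U[U†^{⊗2}(P⊗Q)U^{⊗2}] = 0`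
if `P ≠ Q`"). [cite: AngrisaniEtAl2024, Lemma 7 (orthogonality) and Lemma 13 (orthogonal Pauli paths)] -/
theorem sum_frame_mul_star_eq_zero {g h : Matrix (ι → Bool) (ι → Bool) ℂ → ℂ}
    (hg : ∀ (c : ℂ) (Z : Matrix (ι → Bool) (ι → Bool) ℂ), g (c • Z) = c * g Z)
    (hh : ∀ (c : ℂ) (Z : Matrix (ι → Bool) (ι → Bool) ℂ), h (c • Z) = c * h Z)
    {P P' : ι → Pauli} (hne : P ≠ P') :
    ∑ φ : Frame ι, g ((frameU φ)ᴴ * pauliString P * frameU φ) *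
      star (h ((frameU φ)ᴴ * pauliString P' * frameU φ)) = 0 := by
  simp only [frameU_conj_pauliString, hg, hh, star_mul', star_strSign]
  rw [Fintype.sum_prod_type, Finset.sum_comm]
  refine Finset.sum_eq_zero fun m _ => ?_
  have : ∀ V : ι → Pauli, strSign V P * g (pauliString (rotStr m P)) *
      (strSign V P' * star (h (pauliString (rotStr m P')))) =
      strSign V P * strSign V P' * (g (pauliString (rotStr m P)) * star (h (pauliString (rotStr m P')))) :=
    fun V => by ring
  simp only [this, ← Finset.sum_mul, sum_strSign_mul_strSign, if_neg hne, zero_mul]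

/-! ### Lemma 7, Pauli mixing: the axis average spreads a string over its support -/

/-- **Pauli mixing (Lemma 7, second case), entrywise**: the average over rotation words of
`(rotStr m P)_{xy} conj((rotStr m P)_{x'y'})` is `3^{#{i : Pᵢ = I}}` times the sum of
`R_{xy} conj(R_{x'y'})` over the strings `R` with `Rᵢ = I` where `Pᵢ = I` and `Rᵢ ∈ {X,Y,Z}` elsewhere
("`(1/3^{|P|}) Σ_{supp(Q) = supp(P)} E_U[U†^{⊗2}Q^{⊗2}U^{⊗2}]`", before the outer conjugation).
[cite: AngrisaniEtAl2024, Lemma 7 (Pauli-mixing)] -/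
theorem sum_rotStr_apply_mul_star (P : ι → Pauli) (x y x' y' : ι → Bool) :
    ∑ m : ι → Fin 3, pauliString (rotStr m P) x y * star (pauliString (rotStr m P) x' y') =
      (3 : ℂ) ^ (Finset.univ.filter fun i => P i = Pauli.I).card *
        ∑ R ∈ Fintype.piFinset (fun i => orbit (P i)), pauliString R x y * star (pauliString R x' y') := by
  have hL : ∀ m : ι → Fin 3, pauliString (rotStr m P) x y * star (pauliString (rotStr m P) x' y') =
      ∏ i, ((rotN (m i) (P i)).mat (x i) (y i) * star ((rotN (m i) (P i)).mat (x' i) (y' i))) := by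
    intro m
    rw [pauliString_eq, tensorAll_apply, tensorAll_apply, Complex.star_def, map_prod,
      ← Finset.prod_mul_distrib]
    rfl
  have hR : ∀ R : ι → Pauli, pauliString R x y * star (pauliString R x' y') =
      ∏ i, ((R i).mat (x i) (y i) * star ((R i).mat (x' i) (y' i))) := by
    intro R
    rw [pauliString_eq, tensorAll_apply, tensorAll_apply, Complex.star_def, map_prod,
      ← Finset.prod_mul_distrib]
  have hw : (∏ i : ι, (if P i = Pauli.I then (3 : ℂ) else 1)) =
      (3 : ℂ) ^ (Finset.univ.filter fun i => P i = Pauli.I).card := by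
    rw [Finset.prod_ite, Finset.prod_const_one, mul_one, Finset.prod_const]
  simp only [hL, hR]
  rw [← Fintype.prod_sum (fun i r => (rotN r (P i)).mat (x i) (y i) * star ((rotN r (P i)).mat (x' i) (y' i)))]
  simp only [sum_rotN_mat_mul_star]
  rw [Finset.prod_mul_distrib, hw, Finset.prod_univ_sum (fun i => orbit (P i))
    (fun i Q' => Q'.mat (x i) (y i) * star (Q'.mat (x' i) (y' i)))]

omit [Fintype ι] [DecidableEq ι] in
/-- Swapping a finite outer sum inside a double sum (bookkeeping for second moments). [folklore] -/
private theorem sum_sum_sum_mul_comm {α P : Type*} [Fintype P] (s : Finset α) (T : P → P → ℂ)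
    (K : α → P → P → ℂ) :
    ∑ a ∈ s, ∑ p, ∑ q, T p q * K a p q = ∑ p, ∑ q, T p q * ∑ a ∈ s, K a p q := by
  rw [Finset.sum_comm]
  refine Finset.sum_congr rfl fun p _ => ?_
  rw [Finset.sum_comm]
  refine Finset.sum_congr rfl fun q _ => ?_
  rw [Finset.mul_sum]

/-- **Resummation of second moments through an entrywise kernel identity**: if two families of
matrices `A_a`, `B_b` have proportional two-copy kernels, `Σ_a A_a ⊗ conj A_a = c Σ_b B_b ⊗ conj B_b`
entrywise, then `Σ_a |Tr(A_a τ)|² = c Σ_b |Tr(B_b τ)|²` for every `τ` (the step from the operator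
identity of Lemma 7 to the scalar statements of Lemmas 8–10). [cite: AngrisaniEtAl2024, Lemma 8 (proof: expand the trace in the Pauli/entry basis and use the two-copy average)] -/
theorem sum_norm_trace_sq_of_kernel {α β : Type*} (s : Finset α) (t : Finset β)
    (A : α → Matrix (ι → Bool) (ι → Bool) ℂ) (B : β → Matrix (ι → Bool) (ι → Bool) ℂ) (c : ℝ)
    (hker : ∀ x y x' y', ∑ a ∈ s, A a x y * star (A a x' y') =
      (c : ℂ) * ∑ b ∈ t, B b x y * star (B b x' y'))
    (τ : Matrix (ι → Bool) (ι → Bool) ℂ) :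
    ∑ a ∈ s, ‖(A a * τ).trace‖ ^ 2 = c * ∑ b ∈ t, ‖(B b * τ).trace‖ ^ 2 := by
  classical
  have htr : ∀ M : Matrix (ι → Bool) (ι → Bool) ℂ, (M * τ).trace =
      ∑ p : (ι → Bool) × (ι → Bool), M p.1 p.2 * τ p.2 p.1 := by
    intro M
    rw [Matrix.trace, Fintype.sum_prod_type]
    simp only [Matrix.diag_apply, Matrix.mul_apply]
  have hsq : ∀ M : Matrix (ι → Bool) (ι → Bool) ℂ, ((‖(M * τ).trace‖ : ℝ) : ℂ) ^ 2 =
      ∑ p : (ι → Bool) × (ι → Bool), ∑ q : (ι → Bool) × (ι → Bool),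
        τ p.2 p.1 * star (τ q.2 q.1) * (M p.1 p.2 * star (M q.1 q.2)) := by
    intro M
    rw [← Complex.mul_conj', htr, ← Complex.star_def, star_sum, Finset.sum_mul_sum]
    refine Finset.sum_congr rfl fun p _ => Finset.sum_congr rfl fun q _ => ?_
    rw [star_mul']; ring
  apply Complex.ofReal_injective
  push_cast
  simp only [hsq]
  rw [sum_sum_sum_mul_comm s (fun p q : (ι → Bool) × (ι → Bool) => τ p.2 p.1 * star (τ q.2 q.1))
      (fun a p q => A a p.1 p.2 * star (A a q.1 q.2)),
    sum_sum_sum_mul_comm t (fun p q : (ι → Bool) × (ι → Bool) => τ p.2 p.1 * star (τ q.2 q.1))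
      (fun b p q => B b p.1 p.2 * star (B b q.1 q.2)), Finset.mul_sum]
  refine Finset.sum_congr rfl fun p _ => ?_
  rw [Finset.mul_sum]
  refine Finset.sum_congr rfl fun q _ => ?_
  rw [hker]
  ring

/-- **Pauli mixing in trace form**: `Σ_m |Tr(rotStr_m(P) τ)|² = 3^{#{i : Pᵢ = I}} Σ_R |Tr(R τ)|²`, the
sum over the strings `R` supported exactly where `P` is. [cite: AngrisaniEtAl2024, Lemma 7 (Pauli-mixing) and Lemma 10 (first display)] -/
theorem sum_norm_trace_rotStr_sq (P : ι → Pauli) (τ : Matrix (ι → Bool) (ι → Bool) ℂ) :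
    ∑ m : ι → Fin 3, ‖(pauliString (rotStr m P) * τ).trace‖ ^ 2 =
      (3 : ℝ) ^ (Finset.univ.filter fun i => P i = Pauli.I).card *
        ∑ R ∈ Fintype.piFinset (fun i => orbit (P i)), ‖(pauliString R * τ).trace‖ ^ 2 := by
  refine sum_norm_trace_sq_of_kernel Finset.univ _ (fun m => pauliString (rotStr m P))
    (fun R => pauliString R) _ (fun x y x' y' => ?_) τ
  rw [sum_rotStr_apply_mul_star]
  push_cast
  rfl

/-! ### Lemma 10: high-weight strings have small second moments on states -/

/-- The support `supp(P) = {i : Pᵢ ≠ I}` of a Pauli string as a wire set.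
[cite: AngrisaniEtAl2024, §2 (footnote: supp(P) and |P| := |supp(P)|)] -/
def support (P : ι → Pauli) : Finset ι := Finset.univ.filter fun i => P i ≠ Pauli.I

omit [DecidableEq ι] in
/-- `|supp(P)| = |P|` (the tree's `strWeight`). [cite: AngrisaniEtAl2024, §2 (footnote: |P| := |supp(P)|)] -/
theorem card_support (P : ι → Pauli) : (support P).card = strWeight P := rfl

/-- The strings supported exactly on `supp(P)` are among the strings supported inside `supp(P)`
(the tree's `stringsOn`) — the inequality "`Σ_{supp(Q) ⊆ supp(P)} ≥ Σ_{supp(Q) = supp(P)}`".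
[cite: AngrisaniEtAl2024, Lemma 10 (proof, last inequality of the display)] -/
theorem piFinset_orbit_subset_stringsOn (P : ι → Pauli) :
    Fintype.piFinset (fun i => orbit (P i)) ⊆ stringsOn (support P) := by
  intro R hR
  rw [mem_stringsOn]
  intro i hi
  have h := Fintype.mem_piFinset.1 hR i
  have hPi : P i = Pauli.I := by
    by_contra hne
    exact hi (Finset.mem_filter.2 ⟨Finset.mem_univ _, hne⟩)
  simpa [orbit, hPi] using h

omit [DecidableEq ι] in
/-- `#{i : Pᵢ = I} + |P| = n`. [folklore] -/
private theorem card_filter_eq_I_add_strWeight (P : ι → Pauli) :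
    (Finset.univ.filter fun i => P i = Pauli.I).card + strWeight P = Fintype.card ι := by
  rw [strWeight_eq]
  exact Finset.card_filter_add_card_filter_not _

/-- **Purity bound for the Pauli weight of a state**: for a density matrix `ρ` and a wire set `W`,
`Σ_{supp S ⊆ W} |Tr(S ρ)|² = 2^{|W|} Tr(ρ_W²) ≤ 2^{|W|}` (the reduced state `ρ_W` is a density matrix,
`Tr ρ_W² ≤ (Tr ρ_W)² = 1`; via the tree's `reduceTo` / `pauliWeight_eq_card_pow_mul_norm_reduceTo`).
[cite: AngrisaniEtAl2024, Lemma 10 (proof: Tr[ρ̃²_{supp(P)}] = 2^{-|P|} Σ_Q Tr[Qρ̃]² and Tr[ρ̃²] ≤ 1)] -/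
theorem pauliWeight_le_two_pow {ρ : Matrix (ι → Bool) (ι → Bool) ℂ} (hρ : ρ.PosSemidef)
    (hρ1 : ρ.trace = 1) (W : Finset ι) : pauliWeight ρ W ≤ (2 : ℝ) ^ W.card := by
  rw [pauliWeight_eq_card_pow_mul_norm_reduceTo, sum_norm_sq_eq_re_trace]
  have hρ' := posSemidef_reduceTo W hρ
  rw [hρ'.1]
  have h := Literature.LinearAlgebra.Matrix.re_trace_mul_self_le_sq_of_posSemidef hρ'
  rw [trace_reduceTo, hρ1, Complex.one_re, one_pow] at h
  have h2 : (0 : ℝ) ≤ 2 ^ W.card := by positivity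
  nlinarith

/-- **Lemma 10, rotation part**: `3^{|P|} Σ_m |Tr(rotStr_m(P) ρ)|² ≤ 3^n 2^{|P|}` for a density matrix
`ρ`, i.e. the axis average of `|Tr(rotStr_m(P) ρ)|²` is at most `(2/3)^{|P|}`.
[cite: AngrisaniEtAl2024, Lemma 10] -/
theorem sum_norm_trace_rotStr_sq_le {ρ : Matrix (ι → Bool) (ι → Bool) ℂ} (hρ : ρ.PosSemidef)
    (hρ1 : ρ.trace = 1) (P : ι → Pauli) :
    (3 : ℝ) ^ strWeight P * ∑ m : ι → Fin 3, ‖(pauliString (rotStr m P) * ρ).trace‖ ^ 2 ≤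
      (3 : ℝ) ^ Fintype.card ι * 2 ^ strWeight P := by
  rw [sum_norm_trace_rotStr_sq, ← mul_assoc, ← pow_add, add_comm, card_filter_eq_I_add_strWeight]
  refine mul_le_mul_of_nonneg_left ?_ (by positivity)
  calc ∑ R ∈ Fintype.piFinset (fun i => orbit (P i)), ‖(pauliString R * ρ).trace‖ ^ 2
      ≤ ∑ R ∈ stringsOn (support P), ‖(pauliString R * ρ).trace‖ ^ 2 :=
        Finset.sum_le_sum_of_subset_of_nonneg (piFinset_orbit_subset_stringsOn P)
          fun _ _ _ => sq_nonneg _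
    _ = pauliWeight ρ (support P) := rfl
    _ ≤ 2 ^ strWeight P := by rw [← card_support]; exact pauliWeight_le_two_pow hρ hρ1 _

/-- The same bound, divided through: `Σ_m |Tr(rotStr_m(P) ρ)|² ≤ 3^n (2/3)^{|P|}`.
[cite: AngrisaniEtAl2024, Lemma 10] -/
theorem sum_norm_trace_rotStr_sq_le' {ρ : Matrix (ι → Bool) (ι → Bool) ℂ} (hρ : ρ.PosSemidef)
    (hρ1 : ρ.trace = 1) (P : ι → Pauli) :
    ∑ m : ι → Fin 3, ‖(pauliString (rotStr m P) * ρ).trace‖ ^ 2 ≤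
      (3 : ℝ) ^ Fintype.card ι * (2 / 3) ^ strWeight P := by
  have h3 : (0 : ℝ) < 3 ^ strWeight P := by positivity
  rw [div_pow, mul_div_assoc', le_div_iff₀ h3, mul_comm]
  exact sum_norm_trace_rotStr_sq_le hρ hρ1 P

/-- **Lemma 10, finite-frame form**: for a density matrix `ρ` and a Pauli string `P`,
`Σ_φ |Tr(F_φ† P F_φ ρ)|² ≤ 12^n (2/3)^{|P|}` — "`E_U Tr[U†PUρ]² ≤ (2/3)^{|P|}`" with `12^n` frames.
[cite: AngrisaniEtAl2024, Lemma 10] -/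
theorem sum_frame_norm_trace_sq_le {ρ : Matrix (ι → Bool) (ι → Bool) ℂ} (hρ : ρ.PosSemidef)
    (hρ1 : ρ.trace = 1) (P : ι → Pauli) :
    ∑ φ : Frame ι, ‖((frameU φ)ᴴ * pauliString P * frameU φ * ρ).trace‖ ^ 2 ≤
      (12 : ℝ) ^ Fintype.card ι * (2 / 3) ^ strWeight P := by
  have h1 : ∑ φ : Frame ι, ‖((frameU φ)ᴴ * pauliString P * frameU φ * ρ).trace‖ ^ 2 =
      (4 : ℝ) ^ Fintype.card ι * ∑ m : ι → Fin 3, ‖(pauliString (rotStr m P) * ρ).trace‖ ^ 2 := by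
    simp only [frameU_conj_pauliString, Matrix.smul_mul, Matrix.trace_smul, smul_eq_mul, norm_mul,
      norm_strSign, one_mul]
    rw [Fintype.sum_prod_type]
    dsimp only
    rw [Finset.sum_const, Finset.card_univ, Fintype.card_fun, Pauli.card_univ, nsmul_eq_mul]
    push_cast
    ring
  rw [h1]
  have h3 : (0 : ℝ) < 3 ^ strWeight P := by positivity
  have key := sum_norm_trace_rotStr_sq_le hρ hρ1 P
  rw [div_pow, show (12 : ℝ) ^ Fintype.card ι = 4 ^ Fintype.card ι * 3 ^ Fintype.card ι by
    rw [← mul_pow]; norm_num]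
  rw [mul_div_assoc', le_div_iff₀ h3]
  calc ((4 : ℝ) ^ Fintype.card ι * ∑ m : ι → Fin 3, ‖(pauliString (rotStr m P) * ρ).trace‖ ^ 2) *
        3 ^ strWeight P
      = 4 ^ Fintype.card ι * (3 ^ strWeight P *
          ∑ m : ι → Fin 3, ‖(pauliString (rotStr m P) * ρ).trace‖ ^ 2) := by ring
    _ ≤ 4 ^ Fintype.card ι * (3 ^ Fintype.card ι * 2 ^ strWeight P) :=
        mul_le_mul_of_nonneg_left key (by positivity)
    _ = 4 ^ Fintype.card ι * 3 ^ Fintype.card ι * 2 ^ strWeight P := by ring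

/-! ### Lemmas 8, 9, 11: second moments of twirled observables -/

/-- Conjugating the Pauli expansion: `F† Y F = 2^{−n} Σ_S Tr(S Y) · F† S F`.
[cite: AngrisaniEtAl2024, §9.1 (Pauli expansion, eq. (pauliexp))] -/
theorem conj_eq_sum_pauliCoeff_smul (F Y : Matrix (ι → Bool) (ι → Bool) ℂ) :
    Fᴴ * Y * F = ((2 : ℂ) ^ Fintype.card ι)⁻¹ • ∑ S : ι → Pauli, pauliCoeff Y S • (Fᴴ * pauliString S * F) := by
  conv_lhs => rw [eq_inv_smul_sum_pauliCoeff_smul Y]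
  rw [Matrix.mul_smul, Matrix.smul_mul, Matrix.mul_sum, Matrix.sum_mul]
  congr 1
  refine Finset.sum_congr rfl fun S _ => ?_
  rw [Matrix.mul_smul, Matrix.smul_mul]

/-- An additive homogeneous functional of a twirled operator, expanded in Pauli strings:
`g(F† Y F) = 2^{−n} Σ_S Tr(S Y) g(F† S F)`. [cite: AngrisaniEtAl2024, Lemma 8 (proof, first line: expansion in the normalized Pauli basis)] -/
theorem apply_conj_eq_sum {g : Matrix (ι → Bool) (ι → Bool) ℂ → ℂ}
    (hadd : ∀ Z Z' : Matrix (ι → Bool) (ι → Bool) ℂ, g (Z + Z') = g Z + g Z')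
    (hsmul : ∀ (c : ℂ) (Z : Matrix (ι → Bool) (ι → Bool) ℂ), g (c • Z) = c * g Z)
    (F Y : Matrix (ι → Bool) (ι → Bool) ℂ) :
    g (Fᴴ * Y * F) = ((2 : ℂ) ^ Fintype.card ι)⁻¹ *
      ∑ S : ι → Pauli, pauliCoeff Y S * g (Fᴴ * pauliString S * F) := by
  have hsum : ∀ (s : Finset (ι → Pauli)) (Z : (ι → Pauli) → Matrix (ι → Bool) (ι → Bool) ℂ),
      g (∑ S ∈ s, Z S) = ∑ S ∈ s, g (Z S) := by
    intro s Z
    induction s using Finset.induction_on with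
    | empty =>
      have h0 : g 0 = 0 := by
        have := hsmul 0 0
        rwa [zero_smul, zero_mul] at this
      simpa using h0
    | insert a s ha ih => rw [Finset.sum_insert ha, Finset.sum_insert ha, hadd, ih]
  rw [conj_eq_sum_pauliCoeff_smul, hsmul, hsum]
  congr 1
  exact Finset.sum_congr rfl fun S _ => hsmul _ _

/-- **Parseval for the Pauli-frame characters**, sesquilinear form:
`Σ_V (Σ_S a_S sign_V(S)) conj(Σ_S b_S sign_V(S)) = 4^n Σ_S a_S conj(b_S)`.
[cite: AngrisaniEtAl2024, Lemma 8 (vanishing cross-terms)] -/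
theorem sum_wsum_strSign_mul_star (a b : (ι → Pauli) → ℂ) :
    ∑ V : ι → Pauli, (∑ S, a S * strSign V S) * star (∑ S, b S * strSign V S) =
      (4 : ℂ) ^ Fintype.card ι * ∑ S, a S * star (b S) := by
  have h1 : ∀ V : ι → Pauli, (∑ S, a S * strSign V S) * star (∑ S, b S * strSign V S) =
      ∑ S, ∑ S', a S * star (b S') * (strSign V S * strSign V S') := by
    intro V
    rw [star_sum, Finset.sum_mul_sum]
    refine Finset.sum_congr rfl fun S _ => Finset.sum_congr rfl fun S' _ => ?_
    rw [star_mul', star_strSign]; ring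
  simp only [h1]
  rw [sum_sum_sum_mul_comm Finset.univ (fun S S' => a S * star (b S')) (fun V S S' => strSign V S * strSign V S')]
  simp only [sum_strSign_mul_strSign, mul_ite, mul_zero, Finset.sum_ite_eq, Finset.mem_univ, if_true]
  rw [Finset.mul_sum]
  exact Finset.sum_congr rfl fun S _ => by ring

/-- **Vanishing cross terms** (Lemma 8 / Lemma 15 core): for additive homogeneous functionals `g, h` and
operators `Y, Y'` with disjoint Pauli support (for every string one of the two coefficients vanishes — e.g.
the high- and low-weight parts of one observable), `Σ_φ g(F_φ† Y F_φ) conj(h(F_φ† Y' F_φ)) = 0`.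
[cite: AngrisaniEtAl2024, Lemma 8 and Lemma 15 (cross terms of distinct paths vanish)] -/
theorem sum_frame_apply_conj_mul_star_eq_zero {g h : Matrix (ι → Bool) (ι → Bool) ℂ → ℂ}
    (hgadd : ∀ Z Z' : Matrix (ι → Bool) (ι → Bool) ℂ, g (Z + Z') = g Z + g Z')
    (hgsmul : ∀ (c : ℂ) (Z : Matrix (ι → Bool) (ι → Bool) ℂ), g (c • Z) = c * g Z)
    (hhadd : ∀ Z Z' : Matrix (ι → Bool) (ι → Bool) ℂ, h (Z + Z') = h Z + h Z')
    (hhsmul : ∀ (c : ℂ) (Z : Matrix (ι → Bool) (ι → Bool) ℂ), h (c • Z) = c * h Z)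
    {Y Y' : Matrix (ι → Bool) (ι → Bool) ℂ} (hYY' : ∀ S, pauliCoeff Y S = 0 ∨ pauliCoeff Y' S = 0) :
    ∑ φ : Frame ι, g ((frameU φ)ᴴ * Y * frameU φ) * star (h ((frameU φ)ᴴ * Y' * frameU φ)) = 0 := by
  have e1 : ∀ φ : Frame ι,
      (∑ S : ι → Pauli, pauliCoeff Y S * g ((frameU φ)ᴴ * pauliString S * frameU φ)) *
        star (∑ S : ι → Pauli, pauliCoeff Y' S * h ((frameU φ)ᴴ * pauliString S * frameU φ)) =
      ∑ S, ∑ S', pauliCoeff Y S * star (pauliCoeff Y' S') *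
        (g ((frameU φ)ᴴ * pauliString S * frameU φ) * star (h ((frameU φ)ᴴ * pauliString S' * frameU φ))) := by
    intro φ
    rw [star_sum, Finset.sum_mul_sum]
    refine Finset.sum_congr rfl fun S _ => Finset.sum_congr rfl fun S' _ => ?_
    rw [star_mul']; ring
  have e2 : ∀ φ : Frame ι,
      ((2 : ℂ) ^ Fintype.card ι)⁻¹ * (∑ S : ι → Pauli, pauliCoeff Y S * g ((frameU φ)ᴴ * pauliString S * frameU φ)) *
        star (((2 : ℂ) ^ Fintype.card ι)⁻¹ *
          ∑ S : ι → Pauli, pauliCoeff Y' S * h ((frameU φ)ᴴ * pauliString S * frameU φ)) =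
      ((2 : ℂ) ^ Fintype.card ι)⁻¹ * star (((2 : ℂ) ^ Fintype.card ι)⁻¹) *
        ((∑ S : ι → Pauli, pauliCoeff Y S * g ((frameU φ)ᴴ * pauliString S * frameU φ)) *
          star (∑ S : ι → Pauli, pauliCoeff Y' S * h ((frameU φ)ᴴ * pauliString S * frameU φ))) := by
    intro φ; rw [star_mul']; ring
  have e3 : ∀ φ : Frame ι, g ((frameU φ)ᴴ * Y * frameU φ) * star (h ((frameU φ)ᴴ * Y' * frameU φ)) =
      ((2 : ℂ) ^ Fintype.card ι)⁻¹ * star (((2 : ℂ) ^ Fintype.card ι)⁻¹) *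
        ∑ S, ∑ S', pauliCoeff Y S * star (pauliCoeff Y' S') *
          (g ((frameU φ)ᴴ * pauliString S * frameU φ) *
            star (h ((frameU φ)ᴴ * pauliString S' * frameU φ))) := by
    intro φ
    rw [apply_conj_eq_sum hgadd hgsmul, apply_conj_eq_sum hhadd hhsmul, e2, e1]
  rw [Finset.sum_congr rfl fun φ _ => e3 φ, ← Finset.mul_sum]
  refine mul_eq_zero_of_right _ ?_
  rw [sum_sum_sum_mul_comm Finset.univ (fun S S' => pauliCoeff Y S * star (pauliCoeff Y' S'))
    (fun φ S S' => g ((frameU φ)ᴴ * pauliString S * frameU φ) *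
      star (h ((frameU φ)ᴴ * pauliString S' * frameU φ)))]
  refine Finset.sum_eq_zero fun S _ => Finset.sum_eq_zero fun S' _ => ?_
  by_cases hS : S = S'
  · subst hS
    rcases hYY' S with h0 | h0 <;> simp [h0]
  · rw [sum_frame_mul_star_eq_zero hgsmul hhsmul hS, mul_zero]

/-- **Frame Parseval for the read-out functional** (Lemma 8 with `H = Y`, `H' = τ`):
`Σ_φ |Tr(F_φ† Y F_φ τ)|² = Σ_S |Tr(S Y)|² · Σ_m |Tr(rotStr_m(S) τ)|²` — the Pauli frame diagonalises the
second moment in the Pauli basis ("`E_U Tr[HUH'U†]² = E_U Σ_s Tr[Hs]² Tr[sUH'U†]²`").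
[cite: AngrisaniEtAl2024, Lemma 8 (vanishing cross-terms)] -/
theorem sum_frame_norm_trace_conj_sq (Y τ : Matrix (ι → Bool) (ι → Bool) ℂ) :
    ∑ φ : Frame ι, ‖((frameU φ)ᴴ * Y * frameU φ * τ).trace‖ ^ 2 =
      ∑ S : ι → Pauli, ‖pauliCoeff Y S‖ ^ 2 *
        ∑ m : ι → Fin 3, ‖(pauliString (rotStr m S) * τ).trace‖ ^ 2 := by
  have hg : ∀ φ : Frame ι, ((frameU φ)ᴴ * Y * frameU φ * τ).trace =
      ((2 : ℂ) ^ Fintype.card ι)⁻¹ * ∑ S : ι → Pauli,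
        pauliCoeff Y S * (pauliString (rotStr φ.2 S) * τ).trace * strSign φ.1 S := by
    intro φ
    rw [apply_conj_eq_sum (g := fun Z => (Z * τ).trace) (fun Z Z' => by simp [Matrix.add_mul])
      (fun c Z => by simp) (frameU φ) Y]
    congr 1
    refine Finset.sum_congr rfl fun S _ => ?_
    rw [frameU_conj_pauliString, Matrix.smul_mul, Matrix.trace_smul, smul_eq_mul]
    ring
  apply Complex.ofReal_injective
  push_cast
  simp only [← Complex.mul_conj', ← Complex.star_def, hg]
  rw [Fintype.sum_prod_type, Finset.sum_comm]
  dsimp only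
  have hin : ∀ m : ι → Fin 3, ∑ V : ι → Pauli,
      ((2 : ℂ) ^ Fintype.card ι)⁻¹ * (∑ S, pauliCoeff Y S * (pauliString (rotStr m S) * τ).trace * strSign V S) *
        star (((2 : ℂ) ^ Fintype.card ι)⁻¹ *
          ∑ S, pauliCoeff Y S * (pauliString (rotStr m S) * τ).trace * strSign V S) =
      ∑ S, pauliCoeff Y S * star (pauliCoeff Y S) *
        ((pauliString (rotStr m S) * τ).trace * star ((pauliString (rotStr m S) * τ).trace)) := by
    intro m
    have : ∀ V : ι → Pauli,
        ((2 : ℂ) ^ Fintype.card ι)⁻¹ * (∑ S, pauliCoeff Y S * (pauliString (rotStr m S) * τ).trace * strSign V S) *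
          star (((2 : ℂ) ^ Fintype.card ι)⁻¹ *
            ∑ S, pauliCoeff Y S * (pauliString (rotStr m S) * τ).trace * strSign V S) =
        ((2 : ℂ) ^ Fintype.card ι)⁻¹ * star (((2 : ℂ) ^ Fintype.card ι)⁻¹) *
          ((∑ S, pauliCoeff Y S * (pauliString (rotStr m S) * τ).trace * strSign V S) *
            star (∑ S, pauliCoeff Y S * (pauliString (rotStr m S) * τ).trace * strSign V S)) := by
      intro V; rw [star_mul']; ring
    simp only [this, ← Finset.mul_sum]
    rw [sum_wsum_strSign_mul_star]
    have h4 : ((2 : ℂ) ^ Fintype.card ι)⁻¹ * star (((2 : ℂ) ^ Fintype.card ι)⁻¹) *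
        (4 : ℂ) ^ Fintype.card ι = 1 := by
      rw [star_inv₀, star_pow, Complex.star_def, Complex.conj_ofNat (n := 2),
        show (4 : ℂ) ^ Fintype.card ι = 2 ^ Fintype.card ι * 2 ^ Fintype.card ι by
          rw [← mul_pow]; norm_num]
      have h2 : (2 : ℂ) ^ Fintype.card ι ≠ 0 := pow_ne_zero _ two_ne_zero
      field_simp
    rw [← mul_assoc, h4, one_mul]
    exact Finset.sum_congr rfl fun S _ => by rw [star_mul']; ring
  simp only [hin]
  rw [Finset.sum_comm]
  refine Finset.sum_congr rfl fun S _ => ?_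
  rw [Finset.mul_sum]

/-- **Lemma 11 / Corollary 16 core**: for a density matrix `ρ` and an operator `Y` with NO Pauli
coefficients of weight `≤ k` (a "high-weight part" `O^{(high)}`), the frame average of `|Tr(F_φ† Y F_φ ρ)|²`
is at most `(2/3)^{k+1} ‖Y‖²_F` (times the `12^n` frames):
"`E_U Tr[U† O^{(high)} U ρ]² ≤ (2/3)^{k+1}(‖O‖² − ‖O^{(low)}‖²)`".
[cite: AngrisaniEtAl2024, Lemma 11 (Approximate inner product) and Corollary 16] -/
theorem sum_frame_norm_trace_conj_sq_le {ρ : Matrix (ι → Bool) (ι → Bool) ℂ} (hρ : ρ.PosSemidef)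
    (hρ1 : ρ.trace = 1) {k : ℕ} {Y : Matrix (ι → Bool) (ι → Bool) ℂ}
    (hY : ∀ S : ι → Pauli, strWeight S ≤ k → pauliCoeff Y S = 0) :
    ∑ φ : Frame ι, ‖((frameU φ)ᴴ * Y * frameU φ * ρ).trace‖ ^ 2 ≤
      (12 : ℝ) ^ Fintype.card ι * (2 / 3) ^ (k + 1) * frobSq Y := by
  rw [sum_frame_norm_trace_conj_sq, frobSq_eq_sum_pauliCoeff, ← mul_assoc,
    show (12 : ℝ) ^ Fintype.card ι * (2 / 3) ^ (k + 1) * ((4 : ℝ) ^ Fintype.card ι)⁻¹ =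
      3 ^ Fintype.card ι * (2 / 3) ^ (k + 1) by
      rw [show (12 : ℝ) ^ Fintype.card ι = 4 ^ Fintype.card ι * 3 ^ Fintype.card ι by
        rw [← mul_pow]; norm_num]
      have h4 : (4 : ℝ) ^ Fintype.card ι ≠ 0 := pow_ne_zero _ (by norm_num)
      field_simp,
    Finset.mul_sum]
  refine Finset.sum_le_sum fun S _ => ?_
  by_cases hS : strWeight S ≤ k
  · rw [hY S hS, norm_zero]
    simp only [ne_eq, OfNat.ofNat_ne_zero, not_false_eq_true, zero_pow, zero_mul, mul_zero, le_refl]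
  · rw [mul_comm (3 ^ Fintype.card ι * (2 / 3) ^ (k + 1)) _]
    refine mul_le_mul_of_nonneg_left ?_ (sq_nonneg _)
    refine (sum_norm_trace_rotStr_sq_le' hρ hρ1 S).trans ?_
    refine mul_le_mul_of_nonneg_left ?_ (by positivity)
    exact pow_le_pow_of_le_one (by norm_num) (by norm_num) (by omega)

/-! ### The algorithm: exact and weight-truncated Heisenberg observables of a layered circuit -/

/-- The **exact Heisenberg-evolved observable** `U† Y U` of the layers `W_0, …, W_{L−1}` (applied to
the state in this order), computed top layer first: `heisExact (L+1) W Y = heisExact L (init W) (W_L† Y W_L)`.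
[cite: AngrisaniEtAl2024, §10 (U†(·)U = U_1†U_2†⋯U_L†(·)U_L⋯U_2U_1)] -/
def heisExact : (L : ℕ) → (Fin L → Matrix (ι → Bool) (ι → Bool) ℂ) →
    Matrix (ι → Bool) (ι → Bool) ℂ → Matrix (ι → Bool) (ι → Bool) ℂ
  | 0, _, Y => Y
  | L + 1, W, Y => heisExact L (fun i => W i.castSucc) ((W (Fin.last L))ᴴ * Y * W (Fin.last L))

/-- **Low-weight Pauli propagation** with weight cut-off `k`: truncate the current observable to Pauli
weight `≤ k` (`O_L := Σ_{|P|≤k} a_P P`), conjugate by the top layer, recurse on the layers below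
(`O_{j−1} := (U_j† O_j U_j)^{(low)}`), and do NOT truncate after the bottom layer
(`O^{(k)}_U := U_1† O_1 U_1`). [cite: AngrisaniEtAl2024, §3 (Algorithm, the three bullet points) and §11 (S_k, O_j)] -/
def heisTrunc (k : ℕ) : (L : ℕ) → (Fin L → Matrix (ι → Bool) (ι → Bool) ℂ) →
    Matrix (ι → Bool) (ι → Bool) ℂ → Matrix (ι → Bool) (ι → Bool) ℂ
  | 0, _, Y => Y
  | L + 1, W, Y => heisTrunc k L (fun i => W i.castSucc) ((W (Fin.last L))ᴴ * truncWeight k Y * W (Fin.last L))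

/-- No layers: the exact observable is `Y`. [cite: AngrisaniEtAl2024, §10] -/
@[simp] theorem heisExact_zero (W : Fin 0 → Matrix (ι → Bool) (ι → Bool) ℂ) (Y : Matrix (ι → Bool) (ι → Bool) ℂ) :
    heisExact 0 W Y = Y := rfl

/-- Peeling the top layer off the exact observable. [cite: AngrisaniEtAl2024, §10] -/
theorem heisExact_succ {L : ℕ} (W : Fin (L + 1) → Matrix (ι → Bool) (ι → Bool) ℂ)
    (Y : Matrix (ι → Bool) (ι → Bool) ℂ) :
    heisExact (L + 1) W Y = heisExact L (fun i => W i.castSucc) ((W (Fin.last L))ᴴ * Y * W (Fin.last L)) := rfl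

/-- No layers: the estimate's observable is `Y` itself (no truncation after the bottom layer).
[cite: AngrisaniEtAl2024, §3 (O^{(k)}_U := U_1† O_1 U_1)] -/
@[simp] theorem heisTrunc_zero (k : ℕ) (W : Fin 0 → Matrix (ι → Bool) (ι → Bool) ℂ)
    (Y : Matrix (ι → Bool) (ι → Bool) ℂ) : heisTrunc k 0 W Y = Y := rfl

/-- Peeling the top layer: truncate, conjugate, recurse. [cite: AngrisaniEtAl2024, §3 (Algorithm)] -/
theorem heisTrunc_succ (k : ℕ) {L : ℕ} (W : Fin (L + 1) → Matrix (ι → Bool) (ι → Bool) ℂ)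
    (Y : Matrix (ι → Bool) (ι → Bool) ℂ) :
    heisTrunc k (L + 1) W Y =
      heisTrunc k L (fun i => W i.castSucc) ((W (Fin.last L))ᴴ * truncWeight k Y * W (Fin.last L)) := rfl

/-- Peeling the top layer, `Fin.snoc` form. [cite: AngrisaniEtAl2024, §10] -/
theorem heisExact_snoc {L : ℕ} (W' : Fin L → Matrix (ι → Bool) (ι → Bool) ℂ)
    (w Y : Matrix (ι → Bool) (ι → Bool) ℂ) :
    heisExact (L + 1) (Fin.snoc W' w) Y = heisExact L W' (wᴴ * Y * w) := by
  rw [heisExact_succ]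
  simp only [Fin.snoc_last, Fin.snoc_castSucc]

/-- Peeling the top layer of the estimate, `Fin.snoc` form. [cite: AngrisaniEtAl2024, §3 (Algorithm)] -/
theorem heisTrunc_snoc (k : ℕ) {L : ℕ} (W' : Fin L → Matrix (ι → Bool) (ι → Bool) ℂ)
    (w Y : Matrix (ι → Bool) (ι → Bool) ℂ) :
    heisTrunc k (L + 1) (Fin.snoc W' w) Y = heisTrunc k L W' (wᴴ * truncWeight k Y * w) := by
  rw [heisTrunc_succ]
  simp only [Fin.snoc_last, Fin.snoc_castSucc]

/-- **The exact observable is `C† Y C`** for the circuit unitary `C = W_{L−1} ⋯ W_0` of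
`PauliPathIntegral.lean`. [cite: AngrisaniEtAl2024, §10 (U† O U)] -/
theorem heisExact_eq_conj : ∀ (L : ℕ) (W : Fin L → Matrix (ι → Bool) (ι → Bool) ℂ)
    (Y : Matrix (ι → Bool) (ι → Bool) ℂ),
    heisExact L W Y = (circuitUnitary L W)ᴴ * Y * circuitUnitary L W := by
  intro L
  induction L with
  | zero => intro W Y; simp [circuitUnitary]
  | succ L ih =>
    intro W Y
    rw [heisExact_succ, ih]
    simp only [circuitUnitary, conjTranspose_mul, Matrix.mul_assoc]

/-- A circuit of unitary layers is unitary: `C† C = 1` for `C = U_{L−1} ⋯ U_0`.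
[cite: AharonovEtAl2023, Definition 1 (C = U_d U_{d-1} ⋯ U_1, a unitary circuit)] -/
theorem circuitUnitary_unitary : ∀ (L : ℕ) (W : Fin L → Matrix (ι → Bool) (ι → Bool) ℂ),
    (∀ j, (W j)ᴴ * W j = 1) → (circuitUnitary L W)ᴴ * circuitUnitary L W = 1 := by
  intro L
  induction L with
  | zero => intro W _; simp [circuitUnitary]
  | succ L ih =>
    intro W hW
    simp only [circuitUnitary, conjTranspose_mul, Matrix.mul_assoc]
    rw [← Matrix.mul_assoc (W (Fin.last L))ᴴ, hW, Matrix.one_mul]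
    exact ih _ fun j => hW _

/-- `heisExact` is additive in the observable. [cite: AngrisaniEtAl2024, §10 (linearity of U†(·)U)] -/
theorem heisExact_add (L : ℕ) (W : Fin L → Matrix (ι → Bool) (ι → Bool) ℂ)
    (Y Y' : Matrix (ι → Bool) (ι → Bool) ℂ) :
    heisExact L W (Y + Y') = heisExact L W Y + heisExact L W Y' := by
  simp only [heisExact_eq_conj, Matrix.mul_add, Matrix.add_mul]

/-- `heisExact` respects differences. [cite: AngrisaniEtAl2024, §10] -/
theorem heisExact_sub (L : ℕ) (W : Fin L → Matrix (ι → Bool) (ι → Bool) ℂ)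
    (Y Y' : Matrix (ι → Bool) (ι → Bool) ℂ) :
    heisExact L W (Y - Y') = heisExact L W Y - heisExact L W Y' := by
  simp only [heisExact_eq_conj, Matrix.mul_sub, Matrix.sub_mul]

/-- `heisExact` is homogeneous. [cite: AngrisaniEtAl2024, §10] -/
theorem heisExact_smul (L : ℕ) (W : Fin L → Matrix (ι → Bool) (ι → Bool) ℂ) (c : ℂ)
    (Y : Matrix (ι → Bool) (ι → Bool) ℂ) :
    heisExact L W (c • Y) = c • heisExact L W Y := by
  simp only [heisExact_eq_conj, Matrix.mul_smul, Matrix.smul_mul]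

/-- Weight truncation is additive. [cite: AngrisaniEtAl2024, §3 (O_{j-1} is linear in O_j)] -/
theorem truncWeight_add (k : ℕ) (Y Y' : Matrix (ι → Bool) (ι → Bool) ℂ) :
    truncWeight k (Y + Y') = truncWeight k Y + truncWeight k Y' := by
  refine eq_of_forall_pauliCoeff_eq fun T => ?_
  rw [pauliCoeff_add, pauliCoeff_truncWeight, pauliCoeff_truncWeight, pauliCoeff_truncWeight,
    pauliCoeff_add]
  split_ifs <;> simp

/-- Weight truncation is homogeneous. [cite: AngrisaniEtAl2024, §3] -/
theorem truncWeight_smul (k : ℕ) (c : ℂ) (Y : Matrix (ι → Bool) (ι → Bool) ℂ) :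
    truncWeight k (c • Y) = c • truncWeight k Y := by
  refine eq_of_forall_pauliCoeff_eq fun T => ?_
  rw [pauliCoeff_smul, pauliCoeff_truncWeight, pauliCoeff_truncWeight, pauliCoeff_smul]
  split_ifs <;> simp

/-- The estimate's observable is additive in the input observable (the algorithm is linear).
[cite: AngrisaniEtAl2024, Definition 14 (O_U^{(S)} = Σ_{γ∈S} Φ_γ(U) s_γ is linear in O)] -/
theorem heisTrunc_add (k : ℕ) : ∀ (L : ℕ) (W : Fin L → Matrix (ι → Bool) (ι → Bool) ℂ)
    (Y Y' : Matrix (ι → Bool) (ι → Bool) ℂ),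
    heisTrunc k L W (Y + Y') = heisTrunc k L W Y + heisTrunc k L W Y' := by
  intro L
  induction L with
  | zero => intro W Y Y'; rfl
  | succ L ih =>
    intro W Y Y'
    rw [heisTrunc_succ, heisTrunc_succ, heisTrunc_succ, ← ih, truncWeight_add, Matrix.mul_add,
      Matrix.add_mul]

/-- The estimate's observable is homogeneous in the input observable. [cite: AngrisaniEtAl2024, Definition 14] -/
theorem heisTrunc_smul (k : ℕ) : ∀ (L : ℕ) (W : Fin L → Matrix (ι → Bool) (ι → Bool) ℂ) (c : ℂ)
    (Y : Matrix (ι → Bool) (ι → Bool) ℂ),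
    heisTrunc k L W (c • Y) = c • heisTrunc k L W Y := by
  intro L
  induction L with
  | zero => intro W c Y; rfl
  | succ L ih =>
    intro W c Y
    rw [heisTrunc_succ, heisTrunc_succ, ← ih, truncWeight_smul, Matrix.mul_smul, Matrix.smul_mul]

/-- **Framed layers**: the skeleton layers `U_j` each followed by a local scrambling frame,
`W_j = F_{φ_j} U_j` ("post-processing by random single-qubit Cliffords", layer by layer, independently).
[cite: AngrisaniEtAl2024, Definitions 5–6] -/
def framed {L : ℕ} (U : Fin L → Matrix (ι → Bool) (ι → Bool) ℂ) (φ : Fin L → Frame ι) :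
    Fin L → Matrix (ι → Bool) (ι → Bool) ℂ :=
  fun j => frameU (φ j) * U j

/-- Framed unitary layers are unitary. [cite: AngrisaniEtAl2024, Definitions 5–6 (V U with V, U unitary)] -/
theorem framed_unitary {L : ℕ} {U : Fin L → Matrix (ι → Bool) (ι → Bool) ℂ}
    (hU : ∀ j, (U j)ᴴ * U j = 1) (φ : Fin L → Frame ι) (j : Fin L) :
    (framed U φ j)ᴴ * framed U φ j = 1 := by
  rw [framed, conjTranspose_mul, Matrix.mul_assoc, ← Matrix.mul_assoc (frameU (φ j))ᴴ,
    frameU_unitary, Matrix.one_mul, hU]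

/-- Splitting the top frame off a framed circuit. [folklore] -/
private theorem framed_snoc {L : ℕ} (U : Fin (L + 1) → Matrix (ι → Bool) (ι → Bool) ℂ)
    (φ' : Fin L → Frame ι) (a : Frame ι) :
    framed U (Fin.snoc φ' a) =
      Fin.snoc (framed (fun i => U i.castSucc) φ') (frameU a * U (Fin.last L)) := by
  funext j
  refine Fin.lastCases ?_ (fun i => ?_) j
  · simp [framed, Fin.snoc_last]
  · simp [framed, Fin.snoc_castSucc]

omit [Fintype ι] [DecidableEq ι] in
/-- Sums over `(L+1)`-tuples of frames split into the top frame and the lower `L`-tuple. [folklore] -/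
private theorem sum_snoc {α M : Type*} [Fintype α] [AddCommMonoid M] {L : ℕ} (g : (Fin (L + 1) → α) → M) :
    ∑ φ, g φ = ∑ a : α, ∑ φ' : Fin L → α, g (Fin.snoc φ' a) := by
  rw [← (Fin.snocEquiv fun _ => α).sum_comp, Fintype.sum_prod_type]
  rfl

omit [Fintype ι] [DecidableEq ι] in
/-- `|α + β|² = |α|² + |β|² + 2 Re(α conj β)` in `ℂ`. [folklore] -/
private theorem norm_add_sq_complex (α β : ℂ) : ‖α + β‖ ^ 2 = ‖α‖ ^ 2 + ‖β‖ ^ 2 + 2 * (α * star β).re := by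
  rw [Complex.sq_norm, Complex.sq_norm, Complex.sq_norm, Complex.normSq_add, Complex.star_def]

/-- Reading out a conjugated observable is reading out the observable on the conjugated state:
`Tr(V† Z V ρ) = Tr(Z · VρV†)`. [cite: AngrisaniEtAl2024, §11 (ρ_j := U_j⋯U_1 ρ U_1†⋯U_j†)] -/
theorem trace_conj_mul (V Z ρ : Matrix (ι → Bool) (ι → Bool) ℂ) :
    (Vᴴ * Z * V * ρ).trace = (Z * (V * ρ * Vᴴ)).trace := by
  calc (Vᴴ * Z * V * ρ).trace = (Vᴴ * (Z * V * ρ)).trace := by simp only [Matrix.mul_assoc]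
    _ = (Z * V * ρ * Vᴴ).trace := Matrix.trace_mul_comm _ _
    _ = (Z * (V * ρ * Vᴴ)).trace := by simp only [Matrix.mul_assoc]

/-- Conjugation by a framed layer `F u`, reassociated: `(Fu)† Y (Fu) = u†(F† Y F)u`. [folklore] -/
private theorem conj_mul_eq (F u Y : Matrix (ι → Bool) (ι → Bool) ℂ) :
    (F * u)ᴴ * Y * (F * u) = uᴴ * (Fᴴ * Y * F) * u := by
  rw [conjTranspose_mul]; simp only [Matrix.mul_assoc]

/-- **Splitting the residual of `L+1` layers** into the fresh truncation error made at the top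
(`O^{(high)}` propagated exactly) and the residual of the lower `L` layers fed with `O^{(low)}` — the
telescoping step `Tr[O_{j+1}ρ_{j+1}]² − Tr[O_jρ_j]²` of Theorem 17 in operator form.
[cite: AngrisaniEtAl2024, Theorem 17 (proof, telescoping sum) and Corollary 16] -/
theorem residual_split (k L : ℕ) (W' : Fin L → Matrix (ι → Bool) (ι → Bool) ℂ)
    (u F O : Matrix (ι → Bool) (ι → Bool) ℂ) :
    heisExact L W' (uᴴ * (Fᴴ * O * F) * u) - heisTrunc k L W' (uᴴ * (Fᴴ * truncWeight k O * F) * u) =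
      heisExact L W' (uᴴ * (Fᴴ * (O - truncWeight k O) * F) * u) +
        (heisExact L W' (uᴴ * (Fᴴ * truncWeight k O * F) * u) -
          heisTrunc k L W' (uᴴ * (Fᴴ * truncWeight k O * F) * u)) := by
  have h : uᴴ * (Fᴴ * O * F) * u =
      uᴴ * (Fᴴ * (O - truncWeight k O) * F) * u + uᴴ * (Fᴴ * truncWeight k O * F) * u := by
    rw [← Matrix.add_mul, ← Matrix.mul_add, ← Matrix.add_mul, ← Matrix.mul_add, sub_add_cancel]
  rw [h, heisExact_add]
  abel

omit [Fintype ι] [DecidableEq ι] in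
/-- **Orthogonal error terms add in mean square** (Lemma 15): if `Σ_a α_{ab} conj(β_{ab}) = 0` for every
`b`, then `Σ_{a,b} |α + β|² = Σ|α|² + Σ|β|²`. [cite: AngrisaniEtAl2024, Lemma 15 (Mean squared error)] -/
theorem sum_sum_norm_add_sq {A B : Type*} [Fintype A] [Fintype B] (α β : A → B → ℂ)
    (hcross : ∀ b, ∑ a, α a b * star (β a b) = 0) :
    ∑ a, ∑ b, ‖α a b + β a b‖ ^ 2 = ∑ a, ∑ b, ‖α a b‖ ^ 2 + ∑ a, ∑ b, ‖β a b‖ ^ 2 := by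
  simp only [norm_add_sq_complex, Finset.sum_add_distrib]
  have h0 : ∑ a, ∑ b, 2 * (α a b * star (β a b)).re = 0 := by
    rw [Finset.sum_comm]
    refine Finset.sum_eq_zero fun b _ => ?_
    rw [← Finset.mul_sum, ← Complex.re_sum, hcross b, Complex.zero_re, mul_zero]
  rw [h0, add_zero]

/-! ### Theorem 1 / Theorem 17: the mean squared error of low-weight Pauli propagation -/

/-- **Theorem 17 by induction on the number of layers** (un-normalised: sums over the `12^{nL}` frames).
For every skeleton of unitary layers `U`, every density matrix `ρ`, every observable `O` and cut-off `k`: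
`Σ_φ |Tr[(U_φ† O U_φ − O^{(k)}_{U_φ}) ρ]|² ≤ (2/3)^{k+1} (12^{nL} ‖O‖²_F − Σ_φ ‖O^{(k)}_{U_φ}‖²_F)`.
Step `L → L+1`: split the top frame off (`sum_snoc`), split the residual (`residual_split`) into the
exactly-propagated `O^{(high)}` and the lower residual fed with `O^{(low)}`; the cross term vanishes on
averaging the top frame (`sum_frame_apply_conj_mul_star_eq_zero`: disjoint Pauli supports); the first
term is `≤ 12^n(2/3)^{k+1}‖O^{(high)}‖²_F` per lower frame (`sum_frame_norm_trace_conj_sq_le`, read out on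
the state `u C ρ C† u†`); the second is the induction hypothesis with observable `u†F†O^{(low)}Fu`, whose
norm is `‖O^{(low)}‖_F`; and `‖O‖²_F = ‖O^{(low)}‖²_F + ‖O^{(high)}‖²_F`.
[cite: AngrisaniEtAl2024, Theorem 17 (Approximate path integral) with Corollary 16 and Lemma 15] -/
theorem mse_le_aux (k : ℕ) {ρ : Matrix (ι → Bool) (ι → Bool) ℂ} (hρ : ρ.PosSemidef) (hρ1 : ρ.trace = 1) :
    ∀ (L : ℕ) (U : Fin L → Matrix (ι → Bool) (ι → Bool) ℂ), (∀ j, (U j)ᴴ * U j = 1) →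
      ∀ O : Matrix (ι → Bool) (ι → Bool) ℂ,
        ∑ φ : Fin L → Frame ι,
          ‖((heisExact L (framed U φ) O - heisTrunc k L (framed U φ) O) * ρ).trace‖ ^ 2 ≤
        (2 / 3 : ℝ) ^ (k + 1) * (((12 : ℝ) ^ Fintype.card ι) ^ L * frobSq O -
          ∑ φ : Fin L → Frame ι, frobSq (heisTrunc k L (framed U φ) O)) := by
  intro L
  induction L with
  | zero =>
    intro U _ O
    simp
  | succ L ih =>
    intro U hU O
    -- split the frame of the top layer off
    rw [sum_snoc, sum_snoc]
    simp only [framed_snoc, heisExact_snoc, heisTrunc_snoc, conj_mul_eq, residual_split,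
      Matrix.add_mul, Matrix.trace_add]
    -- notation
    set u := U (Fin.last L) with hu_def
    set U' : Fin L → Matrix (ι → Bool) (ι → Bool) ℂ := fun i => U i.castSucc with hU'_def
    have hu : uᴴ * u = 1 := hU _
    have hU' : ∀ j, (U' j)ᴴ * U' j = 1 := fun j => hU _
    set N : ℝ := (12 : ℝ) ^ Fintype.card ι with hN
    have hcardF : (Fintype.card (Frame ι) : ℝ) = N := by rw [card_frame]; push_cast; rw [hN]
    set Oh := O - truncWeight k O with hOh
    set Yt : Frame ι → Matrix (ι → Bool) (ι → Bool) ℂ :=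
      fun a => uᴴ * ((frameU a)ᴴ * truncWeight k O * frameU a) * u with hYt
    -- orthogonality of the two error terms (average over the frame of the top layer)
    have hcross : ∀ φ' : Fin L → Frame ι, ∑ a : Frame ι,
        (heisExact L (framed U' φ') (uᴴ * ((frameU a)ᴴ * Oh * frameU a) * u) * ρ).trace *
          star (((heisExact L (framed U' φ') (Yt a) - heisTrunc k L (framed U' φ') (Yt a)) * ρ).trace) = 0 := by
      intro φ'
      refine sum_frame_apply_conj_mul_star_eq_zero
        (g := fun Z => (heisExact L (framed U' φ') (uᴴ * Z * u) * ρ).trace)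
        (h := fun Z => ((heisExact L (framed U' φ') (uᴴ * Z * u) -
          heisTrunc k L (framed U' φ') (uᴴ * Z * u)) * ρ).trace)
        ?_ ?_ ?_ ?_ ?_
      · intro Z Z'
        simp only [Matrix.mul_add, Matrix.add_mul, heisExact_add, Matrix.trace_add]
      · intro c Z
        simp only [Matrix.mul_smul, Matrix.smul_mul, heisExact_smul, Matrix.trace_smul, smul_eq_mul]
      · intro Z Z'
        simp only [Matrix.mul_add, Matrix.add_mul, heisExact_add, heisTrunc_add]
        rw [show ∀ A A' B B' : Matrix (ι → Bool) (ι → Bool) ℂ,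
          A + A' - (B + B') = (A - B) + (A' - B') from fun _ _ _ _ => by abel,
          Matrix.add_mul, Matrix.trace_add]
      · intro c Z
        simp only [Matrix.mul_smul, Matrix.smul_mul, heisExact_smul, heisTrunc_smul, ← smul_sub,
          Matrix.trace_smul, smul_eq_mul]
      · intro S
        rw [hOh, pauliCoeff_sub_truncWeight, pauliCoeff_truncWeight]
        by_cases hS : strWeight S ≤ k
        · left; rw [if_neg (not_lt.2 hS)]
        · right; rw [if_neg hS]
    rw [sum_sum_norm_add_sq _ _ hcross]
    -- `Oh = O^{(high)}` has no coefficients of weight `≤ k`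
    have hOh0 : ∀ S : ι → Pauli, strWeight S ≤ k → pauliCoeff Oh S = 0 := by
      intro S hS; rw [hOh, pauliCoeff_sub_truncWeight, if_neg (not_lt.2 hS)]
    -- term A: the fresh truncation error, read out on the state after the lower layers and `u`
    have hA : ∀ φ' : Fin L → Frame ι, ∑ a : Frame ι,
        ‖(heisExact L (framed U' φ') (uᴴ * ((frameU a)ᴴ * Oh * frameU a) * u) * ρ).trace‖ ^ 2 ≤
          N * (2 / 3) ^ (k + 1) * frobSq Oh := by
      intro φ'
      set C := u * circuitUnitary L (framed U' φ') with hC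
      have hCu : Cᴴ * C = 1 := by
        rw [hC, conjTranspose_mul, Matrix.mul_assoc, ← Matrix.mul_assoc uᴴ, hu, Matrix.one_mul]
        exact circuitUnitary_unitary L _ (framed_unitary hU' φ')
      have hτ : (C * ρ * Cᴴ).PosSemidef := hρ.mul_mul_conjTranspose_same C
      have hτ1 : (C * ρ * Cᴴ).trace = 1 := by
        rw [Matrix.trace_mul_cycle, hCu, Matrix.one_mul, hρ1]
      have hα : ∀ a : Frame ι,
          (heisExact L (framed U' φ') (uᴴ * ((frameU a)ᴴ * Oh * frameU a) * u) * ρ).trace =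
            ((frameU a)ᴴ * Oh * frameU a * (C * ρ * Cᴴ)).trace := by
        intro a
        rw [heisExact_eq_conj, ← trace_conj_mul, hC, conjTranspose_mul]
        simp only [Matrix.mul_assoc]
      simp only [hα]
      exact sum_frame_norm_trace_conj_sq_le hτ hτ1 hOh0
    have hA' : ∑ a : Frame ι, ∑ φ' : Fin L → Frame ι,
        ‖(heisExact L (framed U' φ') (uᴴ * ((frameU a)ᴴ * Oh * frameU a) * u) * ρ).trace‖ ^ 2 ≤
          N ^ L * (N * (2 / 3) ^ (k + 1) * frobSq Oh) := by
      rw [Finset.sum_comm]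
      refine (Finset.sum_le_sum fun φ' _ => hA φ').trans ?_
      rw [Finset.sum_const, Finset.card_univ, Fintype.card_fun, card_frame, Fintype.card_fin,
        nsmul_eq_mul]
      push_cast
      rw [hN]
    -- term B: the induction hypothesis for the lower `L` layers with observable `Yt a`
    have hYt_frob : ∀ a : Frame ι, frobSq (Yt a) = frobSq (truncWeight k O) := by
      intro a
      rw [hYt]
      dsimp only
      rw [frobSq_conjTranspose_conj hu, frobSq_conjTranspose_conj (frameU_unitary a)]
    have hB : ∑ a : Frame ι, ∑ φ' : Fin L → Frame ι,
        ‖((heisExact L (framed U' φ') (Yt a) - heisTrunc k L (framed U' φ') (Yt a)) * ρ).trace‖ ^ 2 ≤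
          (2 / 3) ^ (k + 1) * (N * N ^ L * frobSq (truncWeight k O) -
            ∑ a : Frame ι, ∑ φ' : Fin L → Frame ι, frobSq (heisTrunc k L (framed U' φ') (Yt a))) := by
      refine (Finset.sum_le_sum fun a _ => ih U' hU' (Yt a)).trans (le_of_eq ?_)
      simp only [hYt_frob]
      rw [← Finset.mul_sum, Finset.sum_sub_distrib, Finset.sum_const, Finset.card_univ, nsmul_eq_mul,
        hcardF]
      ring
    have hsplit : frobSq O = frobSq (truncWeight k O) + frobSq Oh :=
      frobSq_eq_frobSq_truncateTo_add (lowWeight k) O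
    calc _ ≤ N ^ L * (N * (2 / 3) ^ (k + 1) * frobSq Oh) + (2 / 3) ^ (k + 1) *
          (N * N ^ L * frobSq (truncWeight k O) -
            ∑ a : Frame ι, ∑ φ' : Fin L → Frame ι, frobSq (heisTrunc k L (framed U' φ') (Yt a))) :=
          add_le_add hA' hB
      _ = _ := by rw [hsplit, pow_succ]; ring

/-- The **low-weight Pauli propagation estimate** `f̃^{(k)}_W(O) = Tr[O^{(k)}_W ρ]`.
[cite: AngrisaniEtAl2024, §4 (eq. defining f̃^{(k)}_U(O) := Tr[O^{(k)}_U ρ])] -/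
def lowWeightValue (k : ℕ) {L : ℕ} (W : Fin L → Matrix (ι → Bool) (ι → Bool) ℂ)
    (ρ O : Matrix (ι → Bool) (ι → Bool) ℂ) : ℂ :=
  (heisTrunc k L W O * ρ).trace

/-- **The exact value is `f_W(O) = Tr[O · WρW†]`**, the tree's noiseless circuit value `noisyValue 0`.
[cite: AngrisaniEtAl2024, §2 (f_U(O) := Tr[UρU†O])] -/
theorem trace_heisExact_mul {L : ℕ} (W : Fin L → Matrix (ι → Bool) (ι → Bool) ℂ)
    (ρ O : Matrix (ι → Bool) (ι → Bool) ℂ) :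
    (heisExact L W O * ρ).trace = noisyValue 0 W ρ O := by
  rw [heisExact_eq_conj, noisyValue_rate_zero, trace_conj_mul]

/-- **Theorem 17 (Approximate path integral), finite-frame form**: for every skeleton of unitary layers
`U_0,…,U_{L−1}` on `n` qubits, every density matrix `ρ`, every observable `O` and every `k ≥ 0`, the
average over the `12^{nL}` local scrambling frames `φ` of the squared error of weight-`k` Pauli
propagation on the framed circuit `U_φ` is at most
`(2/3)^{k+1} (‖O‖²_{Pauli,2} − avg_φ ‖O^{(k)}_{U_φ}‖²_{Pauli,2})`.
[cite: AngrisaniEtAl2024, Theorem 17 (Approximate path integral)] -/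
theorem lowWeight_mse_le_sharp (k : ℕ) {L : ℕ} (U : Fin L → Matrix (ι → Bool) (ι → Bool) ℂ)
    (hU : ∀ j, (U j)ᴴ * U j = 1) {ρ : Matrix (ι → Bool) (ι → Bool) ℂ} (hρ : ρ.PosSemidef)
    (hρ1 : ρ.trace = 1) (O : Matrix (ι → Bool) (ι → Bool) ℂ) :
    ((12 : ℝ) ^ (Fintype.card ι * L))⁻¹ *
        ∑ φ : Fin L → Frame ι, ‖noisyValue 0 (framed U φ) ρ O - lowWeightValue k (framed U φ) ρ O‖ ^ 2 ≤
      (2 / 3 : ℝ) ^ (k + 1) * (frobSq O - ((12 : ℝ) ^ (Fintype.card ι * L))⁻¹ *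
        ∑ φ : Fin L → Frame ι, frobSq (heisTrunc k L (framed U φ) O)) := by
  set N : ℝ := (12 : ℝ) ^ (Fintype.card ι * L) with hN
  have hNpos : (0 : ℝ) < N := by positivity
  have h := mse_le_aux k hρ hρ1 L U hU O
  rw [← pow_mul, ← hN] at h
  simp only [← trace_heisExact_mul, lowWeightValue, ← Matrix.trace_sub, ← Matrix.sub_mul]
  have h' := mul_le_mul_of_nonneg_left h (le_of_lt (inv_pos.2 hNpos))
  refine h'.trans (le_of_eq ?_)
  field_simp

/-- **Theorem 1 (Mean squared error), finite-frame form**: "For `k ≥ 0`,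
`E_U(Δf^{(k)}_U(O)) ≤ (2/3)^{k+1} ‖O‖²_{Pauli,2}`", the expectation being the uniform average over the
`12^{nL}` local scrambling frames of an arbitrary fixed skeleton `U` of unitary layers (which implies the
printed statement for every locally scrambling circuit distribution, see the module docstring);
`f_U(O) = noisyValue 0 U ρ O = Tr[O UρU†]`, `f̃^{(k)}_U(O) = lowWeightValue k U ρ O`, `‖O‖²_{Pauli,2} = frobSq O`.
[cite: AngrisaniEtAl2024, Theorem 1 (Mean squared error)] -/
theorem lowWeight_mse_le (k : ℕ) {L : ℕ} (U : Fin L → Matrix (ι → Bool) (ι → Bool) ℂ)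
    (hU : ∀ j, (U j)ᴴ * U j = 1) {ρ : Matrix (ι → Bool) (ι → Bool) ℂ} (hρ : ρ.PosSemidef)
    (hρ1 : ρ.trace = 1) (O : Matrix (ι → Bool) (ι → Bool) ℂ) :
    ((12 : ℝ) ^ (Fintype.card ι * L))⁻¹ *
        ∑ φ : Fin L → Frame ι, ‖noisyValue 0 (framed U φ) ρ O - lowWeightValue k (framed U φ) ρ O‖ ^ 2 ≤
      (2 / 3 : ℝ) ^ (k + 1) * frobSq O := by
  refine (lowWeight_mse_le_sharp k U hU hρ hρ1 O).trans ?_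
  refine mul_le_mul_of_nonneg_left ?_ (by positivity)
  exact sub_le_self _ (mul_nonneg (by positivity) (Finset.sum_nonneg fun φ _ => frobSq_nonneg _))

/-- **Corollary 18 (high-probability form), as a count** (Markov / Chebyshev): for `ε > 0`, the number of
frames at which the squared error exceeds `ε² ‖O‖²_{Pauli,2}` is at most `((2/3)^{k+1}/ε²) · 12^{nL}`;
so `|f − f̃| ≤ ε‖O‖_{Pauli,2}` fails for at most a fraction `δ` of the frames as soon as
`(2/3)^{k+1} ≤ ε²δ`, i.e. "`k ≥ log(2/(3ε²δ))/log(3/2) ∈ O(log(1/(εδ)))`".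
[cite: AngrisaniEtAl2024, Corollary 18 (and the Markov display (eq:markov))] -/
theorem card_lowWeight_error_gt_le (k : ℕ) {L : ℕ} (U : Fin L → Matrix (ι → Bool) (ι → Bool) ℂ)
    (hU : ∀ j, (U j)ᴴ * U j = 1) {ρ : Matrix (ι → Bool) (ι → Bool) ℂ} (hρ : ρ.PosSemidef)
    (hρ1 : ρ.trace = 1) (O : Matrix (ι → Bool) (ι → Bool) ℂ) {ε : ℝ} (hε : 0 < ε) :
    ((Finset.univ.filter fun φ : Fin L → Frame ι =>
        ε ^ 2 * frobSq O < ‖noisyValue 0 (framed U φ) ρ O - lowWeightValue k (framed U φ) ρ O‖ ^ 2).card : ℝ) ≤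
      (2 / 3 : ℝ) ^ (k + 1) / ε ^ 2 * (12 : ℝ) ^ (Fintype.card ι * L) := by
  set N : ℝ := (12 : ℝ) ^ (Fintype.card ι * L) with hN
  have hNpos : 0 < N := by positivity
  set bad := Finset.univ.filter fun φ : Fin L → Frame ι =>
      ε ^ 2 * frobSq O < ‖noisyValue 0 (framed U φ) ρ O - lowWeightValue k (framed U φ) ρ O‖ ^ 2 with hbad
  have htot : ∑ φ : Fin L → Frame ι,
      ‖noisyValue 0 (framed U φ) ρ O - lowWeightValue k (framed U φ) ρ O‖ ^ 2 ≤
        (2 / 3 : ℝ) ^ (k + 1) * frobSq O * N := by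
    have h := lowWeight_mse_le k U hU hρ hρ1 O
    rw [← hN, inv_mul_le_iff₀ hNpos] at h
    linarith
  have hmarkov : (bad.card : ℝ) * (ε ^ 2 * frobSq O) ≤ (2 / 3 : ℝ) ^ (k + 1) * frobSq O * N := by
    refine le_trans ?_ htot
    rw [← nsmul_eq_mul, ← Finset.sum_const]
    refine (Finset.sum_le_sum fun φ hφ => le_of_lt (Finset.mem_filter.1 hφ).2).trans ?_
    exact Finset.sum_le_sum_of_subset_of_nonneg (Finset.filter_subset _ _) fun _ _ _ => sq_nonneg _
  by_cases hO : frobSq O = 0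
  · -- then every error vanishes and `bad` is empty
    have hall : ∀ φ : Fin L → Frame ι,
        ‖noisyValue 0 (framed U φ) ρ O - lowWeightValue k (framed U φ) ρ O‖ ^ 2 = 0 := by
      intro φ
      have h0 : ∑ φ : Fin L → Frame ι,
          ‖noisyValue 0 (framed U φ) ρ O - lowWeightValue k (framed U φ) ρ O‖ ^ 2 ≤ 0 := by
        simpa [hO] using htot
      exact (Finset.sum_eq_zero_iff_of_nonneg fun φ _ => sq_nonneg _).1
        (le_antisymm h0 (Finset.sum_nonneg fun φ _ => sq_nonneg _)) φ (Finset.mem_univ _)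
    have hempty : bad = ∅ := by
      rw [hbad, Finset.filter_eq_empty_iff]
      intro φ _
      rw [hall φ, hO, mul_zero]
      exact lt_irrefl 0
    rw [hempty, Finset.card_empty]
    simp only [Nat.cast_zero]
    positivity
  · have hOpos : 0 < frobSq O := lt_of_le_of_ne (frobSq_nonneg O) (Ne.symm hO)
    have hε2 : 0 < ε ^ 2 * frobSq O := mul_pos (pow_pos hε 2) hOpos
    rw [← le_div_iff₀ hε2] at hmarkov
    refine hmarkov.trans (le_of_eq ?_)
    field_simp

end LocalScrambling

end Literature.Computability.QuantumComplexity
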